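/- Width seat `ym-line-cbag-p1-w2` (prover-ym-line-cbag-p1-w2-g4-0), route `ColdBoxAllGroups`, crux `BoxFloorAllGroups`
(stmt-QuantumFields-22254, CLOSED proved): hypothesis audit of the BOX half — simplicity of `G` is idle. -/
import Summits.QuantumFields.YangMills.Theorems.ColdBoxAllGroupsBoxFloorAllGroupsExplicit

/-!
# Route `ColdBoxAllGroups`, BOX half WITHOUT simplicity: cold-box Gaussian domination for every compact group presented in `U(N)`
# with positive chart dimension

Hypothesis audit of the proved crux `BoxFloorAllGroups` (stmt-QuantumFields-22254, `BoxFloorAllGroups_proof`): in the whole proof the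
hypothesis `IsCompactSimpleLieGroup G` (connected, non-abelian, simple, linear) is consumed at exactly ONE place — `1 ≤ D`,
`D = dimE r.ρ` (`dimE_pos_of_isCompactSimpleLieGroup`), in the last step `(D/4 − 1/8)·2Π² ≥ Π²/4`.  Every brick of the line
(`ExpChartPackage2`, `ChartDensityJ`, `RepresentationG`, `GoodReductionG`, `LargeFieldG`, `CoreG`, `ExponentsG`, the group-free Gaussian side)
is a statement about a faithful continuous unitary representation `ρ : G →* U(N)` of a compact group, nothing more.  This file records the
audit as theorems, at the level of `ρ` (any Borel structure on `G`):
* `boxDirichletDominationAbs_of_rep` — S2 without simplicity (explicit window `θ ≤ 1/100`, `κ = 9θ`): eventually in `β`, for all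
  `T ≤ H = ⌈β^θ⌉`, `|β²·boxPlaqCov ρ β H T − (D/4)·boxDirCircSqCov H T| ≤ β^{−9θ}` — the proof is the lead's assembly B9b VERBATIM with
  `r.ρ ↦ ρ` (the simplicity binder of the registered stub was never used);
* `boxGaussianDomination_of_rep` — S3: the relative form `|β²·boxPlaqCov − (D/4)·boxCircSqCov| ≤ (1/8)·boxCircSqCov` at `T = ⌈β^A⌉`,
  `0 < A < θ ≤ 1/100` (the lead's `gaussianDomination_of_abs_dim_at`);
* `boxTwoPointDomination_of_dimE_pos` — BOX for every compact `G`, every faithful continuous unitary `ρ` with `0 < dimE ρ`: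
  for all `0 < A < θ ≤ 1/100` some `c > 0` has `BoxTwoPointDomination ρ A θ c`;
* `boxFloor_of_dimE_pos` — the crux's `∃ θ₀`-shape for `r : LatticeRep G` with `0 < dimE r.ρ` (the crux `BoxFloorAllGroups` itself is
  `boxFloor_of_dimE_pos G r (dimE_pos_of_isCompactSimpleLieGroup G r hG)` — the audit loses nothing; not restated here, it is
  `BoxFloorAllGroups_proof`).
So the BOX half of the rung R2xi-G holds for `U(1)`, tori, `U(N)`, `SO(N)`, and every non-simple compact Lie group alike: the cold-box
Gaussian floor never sees non-abelian structure.  No sorry; no new definition; standard axioms.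
NOT a claim about the Yang–Mills mass gap (rung-level support of a RECORD-label rung; no summit statement is touched).
-/

set_option autoImplicit false

noncomputable section

open MeasureTheory ProbabilityTheory Finset Real Filter Topology Metric
open Literature.Probability.LatticeModels (Site)
open Literature.MathematicalPhysics.QuantumLattice
open Literature.MathematicalPhysics.QuantumFieldTheory
open Literature.MathematicalPhysics.QuantumFieldTheory.LatticeMaxwell
open Literature.MathematicalPhysics.QuantumFieldTheory.AxialGauge
open Summit.QuantumFields.YangMills.Theorems.WeakCouplingRates
open Summit.QuantumFields.YangMills.Theorems.FreeEnergyLogCoefficient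

namespace Summit.QuantumFields.YangMills.Theorems.ColdBoxAllGroups

section Rep

variable {N : ℕ} {G : Type} [Group G] [TopologicalSpace G] [IsTopologicalGroup G] [CompactSpace G]
  [MeasurableSpace G] [BorelSpace G] (ρ : G →* Matrix (Fin N) (Fin N) ℂ)

/-- **S2 without simplicity — the absolute one-scale comparison of the cold-wall box with its temporal-gauge Dirichlet Gaussian, for every
compact group presented faithfully in `U(N)`.**  For a faithful continuous unitary `ρ : G →* U(N)` (`G` compact, any Borel structure) and
`0 < θ ≤ 1/100`: eventually in `β`, for every `T ≤ H = ⌈β^θ⌉`, `|β²·boxPlaqCov ρ β H T − (D/4)·boxDirCircSqCov H T| ≤ β^{−9θ}`,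
`D = dimE ρ`.  The proof is the assembly of the registered stub `stub_boxDirichletDominationAbsG` verbatim (bricks B5-J, B4', B2, B9a, B9c of
the line `birth`), whose simplicity binder was unused. -/
theorem boxDirichletDominationAbs_of_rep (hρc : Continuous ρ) (hinj : Function.Injective ρ)
    (hρu : ∀ g, ρ g ∈ Matrix.unitaryGroup (Fin N) ℂ) {θ : ℝ} (hθ : 0 < θ) (hθ1 : θ ≤ 1 / 100) :
    ∃ β₀ : ℝ, ∀ β : ℝ, β₀ ≤ β → ∀ T : ℕ, T ≤ ⌈β ^ θ⌉₊ →
      |β ^ 2 * boxPlaqCov ρ β ⌈β ^ θ⌉₊ T - (dimE ρ : ℝ) / 4 * boxDirCircSqCov ⌈β ^ θ⌉₊ T| ≤ β ^ (-(9 * θ)) := by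
  haveI : SecondCountableTopology (Matrix (Fin N) (Fin N) ℂ) := inferInstanceAs (SecondCountableTopology (Fin N → Fin N → ℂ))
  haveI : SecondCountableTopology G := (hρc.isClosedEmbedding hinj).isEmbedding.secondCountableTopology
  -- the chart density (B5-J)
  obtain ⟨r₂, C₂, cH, hr₂, -, hC₂, hcH, J, hJc, hJb, hJhalf, hdens⟩ :=
    exists_chartMeasureE_restrict_closedBall_eq_withDensity ρ hρc hinj hρu
  -- eventual facts: the exponent window (B9c), the link window (ChartWindowG), the conditioning (B2)
  have hwin5 : 2 * θ + 3 * θ < 1 / 2 := by linarith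
  obtain ⟨β₁, hE⟩ := Filter.eventually_atTop.1 ((eventually_oneScale_boundsG N (dimE ρ) hθ hθ1 hr₂ hC₂).and
    (eventually_linkWindow_subset_image_expChart ρ hρc hinj hρu (ε := 3 * θ) hθ.le hwin5 one_pos))
  obtain ⟨β₂, hcondE⟩ := abs_boxPlaqCov_sub_cond_le_of_rep ρ hρc hρu hθ (by linarith : 2 * θ < 3 * θ)
  obtain ⟨β₃, hG0E⟩ := boxState_coldGoodSetG_ne_zero ρ hρc hρu hθ (by linarith : 2 * θ < 3 * θ)
  refine ⟨max β₁ (max β₂ β₃), fun β hβ T hT => ?_⟩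
  have hb₁ : β₁ ≤ β := (le_max_left _ _).trans hβ
  have hb₂ : β₂ ≤ β := ((le_max_left _ _).trans (le_max_right _ _)).trans hβ
  have hb₃ : β₃ ≤ β := ((le_max_right _ _).trans (le_max_right _ _)).trans hβ
  obtain ⟨⟨hβ1, hm4, hmr₂, hmEm, hwin, hp1, hfinal⟩, -, hball⟩ := hE β hb₁
  -- names for the one-scale quantities
  set H : ℕ := ⌈β ^ θ⌉₊ with hHdef
  set η : ℝ := (12 * (H : ℝ) ^ 2 + 2 * H + 1) * (Real.sqrt 2 * Real.sqrt (β ^ (2 * (3 * θ) - 1))) with hηdef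
  set m : ℝ := 2 * η with hmdef
  set R : ℝ := β ^ (3 * θ) / (2 * (Real.sqrt (dimE ρ) + 1)) with hRdef
  set p : ℝ := 240 * (dimE ρ : ℝ) * (2 * (H : ℝ) + 1) ^ 4 * Real.exp (-R ^ 2 / 2) with hpdef
  set ℓ : ℝ := 2 * C₂ * m ^ 2 with hℓdef
  have hβ0 : 0 < β := by linarith
  have hH : 1 ≤ H := by
    have := (one_le_ceil_rpow_and_le (A := θ) hβ1 hθ.le).1
    exact_mod_cast this
  have hη0 : 0 < η := by
    have : 0 < Real.sqrt (β ^ (2 * (3 * θ) - 1)) := Real.sqrt_pos.2 (Real.rpow_pos_of_pos hβ0 _)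
    positivity
  have hm0 : 0 < m := by positivity
  have hℓ0 : 0 ≤ ℓ := by positivity
  have hR0 : 0 ≤ R := by positivity
  have hmE4 : Real.sqrt (dimE ρ) * ((12 * (H : ℝ) ^ 2 + 2 * H + 1) * R) / Real.sqrt β ≤ 1 / 4 := hmEm.trans hm4
  -- the density hypotheses at radius `m`
  have hgpos : ∀ a : EuclideanSpace ℝ (Fin (dimE ρ)), ‖a‖ ≤ m → 0 < J a := fun a ha => by
    linarith [(hJhalf a (ha.trans hmr₂)).1]
  have hg : ∀ a : EuclideanSpace ℝ (Fin (dimE ρ)), ‖a‖ ≤ m → |Real.log (J a)| ≤ ℓ := fun a ha => by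
    refine (abs_log_jacobian_le hJb hJhalf a (ha.trans hmr₂)).trans ?_
    rw [hℓdef]
    have : ‖a‖ ^ 2 ≤ m ^ 2 := pow_le_pow_left₀ (norm_nonneg _) ha 2
    nlinarith
  have hc0 : ENNReal.ofReal cH ≠ 0 := by rw [ENNReal.ofReal_ne_zero_iff]; exact hcH
  have hdensm := hdens m hm0 hmr₂
  -- the two charged events
  have hG0 : boxState ρ β H (coldGoodSetG ρ H β (3 * θ)) ≠ 0 := hG0E β hb₃
  haveI : IsProbabilityMeasure (gaussD H (dimE ρ)) := isProbabilityMeasure_gaussD H (dimE ρ)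
  have hSm : MeasurableSet (goodTE ρ H β (3 * θ) ∩ {t | ∀ e, ‖unscaleTE H (dimE ρ) β t e‖ ≤ m}) :=
    (measurableSet_goodTE ρ hρc hinj β (3 * θ)).inter (measurableSet_ball_unscaleTE (dimE ρ) β m)
  have hpS : (gaussD H (dimE ρ)).real (goodTE ρ H β (3 * θ) ∩ {t | ∀ e, ‖unscaleTE H (dimE ρ) β t e‖ ≤ m})ᶜ ≤ p :=
    gaussD_real_compl_goodTE_inter_ball_le ρ hρc hβ0 hH hR0 hmE4 hmEm hwin
  have hγ : gaussD H (dimE ρ) (goodTE ρ H β (3 * θ) ∩ {t | ∀ e, ‖unscaleTE H (dimE ρ) β t e‖ ≤ m}) ≠ 0 :=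
    measure_ne_zero_of_real_compl_lt_one _ hSm (hpS.trans_lt hp1)
  -- the representation (B4') at radius `m = 2η`
  have hrep : ∀ X : LGConfig 4 G → ℝ, Measurable X → IsZdGaugeInvariant X → (∀ U, 0 ≤ X U) →
      ∫ U, X U ∂((boxState ρ β H)[|coldGoodSetG ρ H β (3 * θ)]) =
        ∫ t, X (cfgTE ρ H β t) ∂(((gaussD H (dimE ρ))[|(goodTE ρ H β (3 * θ) ∩ {t | ∀ e, ‖unscaleTE H (dimE ρ) β t e‖ ≤ m})]).tilted
          ((goodTE ρ H β (3 * θ) ∩ {t | ∀ e, ‖unscaleTE H (dimE ρ) β t e‖ ≤ m}).indicator (tiltWE ρ H J β))) :=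
    fun X hXm hXinv hX0 => integral_cond_boxState_eq_integral_tilted_G' ρ hρc hinj hρu hβ0 hH hm4 hball hJc.measurable hgpos hc0
      ENNReal.ofReal_ne_top hdensm hG0 hγ hXm hXinv hX0
  -- the deterministic core (B9a)
  have hcore := abs_boxPlaqCov_sub_dirCircSqCov_le_coreG ρ hρc hinj hρu (ε := 3 * θ) (m := m) (ℓ := ℓ) (R := R) (p := p) (T := T)
    (c₀ := 24 * (N : ℝ) ^ 2 * Real.exp (-(β ^ (3 * θ)))) hJc.measurable hβ1 hH hT hm0.le hm4 hℓ0 hg hR0 hmE4 hmEm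
    hwin le_rfl hp1 hrep (hcondE β hb₂ T)
  -- the final smallness (B9c): monotonicity in the tilt size, then `≤ β^{−9θ}`
  refine hcore.trans (le_trans ?_ hfinal)
  have hτ0 : 0 ≤ 190 * β * m ^ 3 := by positivity
  have hw := tiltSize_le_cardBound H hτ0 hℓ0
  have hexp : Real.exp (2 * ((#(plaquettesTouching (boxEdges 4 (2 * H + 1))) : ℝ) * (190 * β * m ^ 3) +
      (Fintype.card (ColdFreeIdx H) : ℝ) * ℓ)) ≤
      Real.exp (2 * (120 * (2 * (H : ℝ) + 1) ^ 4 * (190 * β * m ^ 3) + 4 * (2 * (H : ℝ) + 1) ^ 4 * ℓ)) :=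
    Real.exp_le_exp.2 (by linarith)
  have hM0 : 0 ≤ 3 * (β ^ (2 * (3 * θ))) ^ 2 := by positivity
  have key := mul_le_mul_of_nonneg_left (sub_le_sub_right hexp 1) hM0
  linarith [key]

/-- **S3 without simplicity — the relative Gaussian domination at `T = ⌈β^A⌉`, every compact group presented faithfully in `U(N)`:**
for `0 < A < θ ≤ 1/100`, eventually in `β`, `|β²·boxPlaqCov ρ β ⌈β^θ⌉ ⌈β^A⌉ − (D/4)·boxCircSqCov ⌈β^θ⌉ ⌈β^A⌉| ≤ (1/8)·boxCircSqCov ⌈β^θ⌉ ⌈β^A⌉`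
(`boxDirichletDominationAbs_of_rep` at `κ = 9θ > 8θ` fed to the lead's `gaussianDomination_of_abs_dim_at`). -/
theorem boxGaussianDomination_of_rep (hρc : Continuous ρ) (hinj : Function.Injective ρ)
    (hρu : ∀ g, ρ g ∈ Matrix.unitaryGroup (Fin N) ℂ) {A θ : ℝ} (hA : 0 < A) (hAθ : A < θ) (hθ1 : θ ≤ 1 / 100) :
    ∃ β₀ : ℝ, ∀ β : ℝ, β₀ ≤ β →
      |β ^ 2 * boxPlaqCov ρ β ⌈β ^ θ⌉₊ ⌈β ^ A⌉₊ - (dimE ρ : ℝ) / 4 * boxCircSqCov ⌈β ^ θ⌉₊ ⌈β ^ A⌉₊| ≤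
        1 / 8 * boxCircSqCov ⌈β ^ θ⌉₊ ⌈β ^ A⌉₊ :=
  gaussianDomination_of_abs_dim_at (fun β H T => β ^ 2 * boxPlaqCov ρ β H T) (D := (dimE ρ : ℝ)) (Nat.cast_nonneg _)
    hA hAθ (by linarith [hA.trans hAθ] : 8 * θ < 9 * θ)
    (boxDirichletDominationAbs_of_rep ρ hρc hinj hρu (hA.trans hAθ) hθ1)

/-- **BOX without simplicity — cold-box two-point domination for every compact group presented faithfully in `U(N)` with positive chart
dimension.**  For a faithful continuous unitary `ρ : G →* U(N)` with `0 < dimE ρ` and all `0 < A < θ ≤ 1/100` there is `c > 0`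
(`= c₁²/4`, `c₁` from the group-free S4 `stub_boxKernelVsLattice`) with `BoxTwoPointDomination ρ A θ c`: eventually in `β`,
`β²·boxPlaqCov ρ β ⌈β^θ⌉ ⌈β^A⌉ ≥ c·curvaturePlaquetteCorr(⌈β^A⌉)²`.  The endgame is `BoxFloorAllGroups_proof`'s, verbatim:
`β²Cov ≥ (D/4 − 1/8)·2Π² ≥ Π²/4 ≥ (c₁²/4)·C(T)²` (S3a `stub_boxGaussianWick`), using `1 ≤ D` and nothing else about `G`. -/
theorem boxTwoPointDomination_of_dimE_pos (hρc : Continuous ρ) (hinj : Function.Injective ρ)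
    (hρu : ∀ g, ρ g ∈ Matrix.unitaryGroup (Fin N) ℂ) (hD : 0 < dimE ρ) {A θ : ℝ} (hA : 0 < A) (hAθ : A < θ)
    (hθ1 : θ ≤ 1 / 100) : ∃ c : ℝ, 0 < c ∧ BoxTwoPointDomination ρ A θ c := by
  have hD1 : (1 : ℝ) ≤ (dimE ρ : ℝ) := by exact_mod_cast Nat.succ_le_of_lt hD
  obtain ⟨β₀, h₀⟩ := boxGaussianDomination_of_rep ρ hρc hinj hρu hA hAθ hθ1
  obtain ⟨c₁, hc₁, β₁, h₁⟩ := stub_boxKernelVsLattice A θ hA hAθ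
  refine ⟨c₁ ^ 2 / 4, by positivity, max β₀ β₁, fun β hβ => ?_⟩
  have h0 := (abs_le.1 (h₀ β (le_trans (le_max_left _ _) hβ))).1
  have h1 := h₁ β (le_trans (le_max_right _ _) hβ)
  have hW := stub_boxGaussianWick ⌈β ^ θ⌉₊ ⌈β ^ A⌉₊
  set P := boxMaxwellPlaqCov ⌈β ^ θ⌉₊ ⌈β ^ A⌉₊ with hP
  set S := boxCircSqCov ⌈β ^ θ⌉₊ ⌈β ^ A⌉₊ with hS
  have hS2 : S = 2 * P ^ 2 := hW
  have hPsq : 0 ≤ P ^ 2 := sq_nonneg _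
  have h1' : (c₁ * |curvaturePlaquetteCorr (d := 4) (by norm_num) (⌈β ^ A⌉₊ : ℤ)|) ^ 2 ≤ |P| ^ 2 :=
    pow_le_pow_left₀ (by positivity) h1 2
  rw [sq_abs, mul_pow, sq_abs] at h1'
  have hmain : (1 / 4 : ℝ) * P ^ 2 ≤ β ^ 2 * boxPlaqCov ρ β ⌈β ^ θ⌉₊ ⌈β ^ A⌉₊ := by
    have : ((dimE ρ : ℝ) / 4 - 1 / 8) * S ≤ β ^ 2 * boxPlaqCov ρ β ⌈β ^ θ⌉₊ ⌈β ^ A⌉₊ := by linarith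
    rw [hS2] at this
    nlinarith
  calc c₁ ^ 2 / 4 * curvaturePlaquetteCorr (d := 4) (by norm_num) (⌈β ^ A⌉₊ : ℤ) ^ 2
      = (1 / 4 : ℝ) * (c₁ ^ 2 * curvaturePlaquetteCorr (d := 4) (by norm_num) (⌈β ^ A⌉₊ : ℤ) ^ 2) := by ring
    _ ≤ (1 / 4 : ℝ) * P ^ 2 := by gcongr
    _ ≤ _ := hmain

end Rep

/-- **The crux shape without simplicity.**  For every compact `G` (any Borel structure) and every faithful unitary lattice representation
`r` with positive chart dimension `0 < dimE r.ρ` there is `θ₀ > 0` (`= 1/100`) such that for all `0 < A < θ ≤ θ₀` some `c > 0` satisfies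
`BoxTwoPointDomination r.ρ A θ c` — literally the body of `Theses.ColdBoxAllGroups.BoxFloorAllGroups` with `IsCompactSimpleLieGroup G`
replaced by `0 < dimE r.ρ`. -/
theorem boxFloor_of_dimE_pos (G : Type) [Group G] [TopologicalSpace G] [IsTopologicalGroup G] [CompactSpace G]
    [MeasurableSpace G] [BorelSpace G] (r : LatticeRep G) (hD : 0 < dimE r.ρ) :
    ∃ θ₀ : ℝ, 0 < θ₀ ∧ ∀ A θ : ℝ, 0 < A → A < θ → θ ≤ θ₀ → ∃ c : ℝ, 0 < c ∧ BoxTwoPointDomination r.ρ A θ c :=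
  ⟨1 / 100, by norm_num, fun _ _ hA hAθ hθ =>
    boxTwoPointDomination_of_dimE_pos r.ρ r.continuous r.injective r.mem_unitary hD hA hAθ hθ⟩

end Summit.QuantumFields.YangMills.Theorems.ColdBoxAllGroups

end
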